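import Mathlib
import Summits.RiemannHypothesis.RiemannHypothesis.Theorems.JensenPolynomialsDefs
import Summits.RiemannHypothesis.RiemannHypothesis.Theses.JensenPolynomials
import Summits.RiemannHypothesis.RiemannHypothesis.Theorems.JensenHermiteSignTest
import Summits.RiemannHypothesis.RiemannHypothesis.Theorems.JensenTuranEnergyTable
import Summits.RiemannHypothesis.RiemannHypothesis.Theorems.JensenWindowEnergy
import Literature.NumberTheory.LFunctions.XiMoments

/-! # JensenWindowTable — S-H3: the window table `rhoWin` and the route's table `rhoWinMin` (window + bound-rows 5, 6) are
admissible: `hermiteCriticalRatioBound_win`, `hermiteCriticalRatioBound_winMin`, and the ITEM CLOSER of the route item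
`JensenPolynomials.HermiteCriticalRatioWindow := HermiteCriticalRatioBound rhoWinMin`.  Ingredients: the Turán-energy table
(`JensenTuranEnergyTable`), the energy bootstrap and Hermite layer (`JensenWindowEnergy`), the generic assembly
`Win.window_row_of_ubound`, the explicit damped-recurrence polynomials `u₃`, `u₄` with their sharp sup bounds
(`Win.u_three_bound` `|u₃| ≤ 4 + 10/d`, `Win.u_four_bound` `|u₄| ≤ 5 + 30/d + 8/d²`) and the bound-rows
`Win.bound_row_three/four`.  RH-FREE, ξ-free (Hermite polynomials only).  Verbatim port of HOME `rh-jensen-theory/JensenTargets.lean`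
v4.6 §8.9 (second half), §8.11 (cell rh-jensen, D-0040; D-0064(4)).  Nothing here bears on the zeros of `ζ`. -/

noncomputable section
set_option linter.dupNamespace false

open Polynomial Finset
open scoped Nat

namespace Summit.RiemannHypothesis.RiemannHypothesis.Theorems.JensenPolynomials

open Literature.NumberTheory.LFunctions

/-- `x^{n/2} = (√x)^n` for `x ≥ 0`. -/
theorem rpow_half_eq_sqrt_pow {x : ℝ} (hx : 0 ≤ x) (n : ℕ) : x ^ ((n : ℝ) / 2) = Real.sqrt x ^ n := by
  rw [Real.sqrt_eq_rpow, ← Real.rpow_natCast, ← Real.rpow_mul hx]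
  congr 1; ring

/-- **S-H3 window instance PROVED (ξ-free, RH-FREE, every `d`)**: `HermiteCriticalRatioBound ρ_win` — the route's
support item `HermiteCriticalRatioWindow` (`JensenPolynomials` route, §10.6) is HOME-PROVED; port = copy of §8.8–§8.9. -/
theorem hermiteCriticalRatioBound_win : HermiteCriticalRatioBound rhoWin := by
  intro d j y hj1 hjd hy
  unfold rhoWin
  by_cases h4 : j ≤ 4
  · rw [if_pos h4]; exact hermiteCriticalRatioBound_turan d j y hj1 hjd hy
  rw [if_neg h4]
  by_cases hw : 4 * (j - 2) ^ 3 ≤ d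
  swap
  · rw [if_neg hw]; exact hermiteCriticalRatioBound_turan d j y hj1 hjd hy
  rw [if_pos hw]
  obtain ⟨i, rfl⟩ : ∃ i, j = i + 2 := ⟨j - 2, by omega⟩
  have hi : 3 ≤ i := by omega
  have hw' : 4 * i ^ 3 ≤ d := by simpa using hw
  have h27 : 27 ≤ i ^ 3 := le_trans (by norm_num) (Nat.pow_le_pow_left hi 3)
  obtain ⟨m, rfl⟩ : ∃ m, d = m + 2 := ⟨d - 2, by omega⟩
  have hy' : (gorzHermite (m + 1)).eval y = 0 := by simpa using hy
  have hZ := hermiteZeroBound_holds (m + 1) y hy'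
  have hy2 : |y| ≤ 2 * Real.sqrt (2 * ((m : ℝ) + 2)) := by
    have : Real.sqrt (2 * ((m + 1 : ℕ) : ℝ) + 1) ≤ Real.sqrt (2 * ((m : ℝ) + 2)) :=
      Real.sqrt_le_sqrt (by push_cast; linarith)
    linarith [hZ.le]
  have hcore := Win.window_row_core m i y hi (by simpa using hw') hy' hy2
  rw [show m + 2 - (i + 2) = m - i by omega, rpow_half_eq_sqrt_pow (by positivity) (i + 2)]
  push_cast
  rw [show (2 : ℝ) * ((m : ℝ) + 2) = 2 * ((m : ℝ) + 2) from rfl] at hcore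
  have hr : 0 < Real.sqrt (2 * ((m : ℝ) + 2)) ^ (i + 2) := pow_pos (by positivity) _
  rw [div_mul_eq_mul_div, le_div_iff₀ hr]
  have : (i : ℝ) + 2 - 1 = (i : ℝ) + 1 := by ring
  rw [this]
  exact hcore

namespace Win

/-- The window-row assembly of §8.9 from an ABSTRACT bound `|u_i| ≤ K` on the damped recurrence and the final numeric
inequality `K·d^{i+1} ≤ (6/5)(i+1)·(d−1)·∏_{l<i}(d−2−l)` (here `d = m + 2`). -/
theorem window_row_of_ubound (m i : ℕ) (y K C : ℝ) (him : i + 3 ≤ m)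
    (hy : (gorzHermite (m + 1)).eval y = 0) (hy2 : |y| ≤ 2 * Real.sqrt (2 * ((m : ℝ) + 2)))
    (hK : ∀ (t : ℝ) (u : ℕ → ℝ), |t| ≤ 2 → u 0 = 1 → u 1 = t →
      (∀ k : ℕ, k + 2 ≤ m → u (k + 2) = t * u (k + 1) - u k + ((k : ℝ) + 2) / ((m : ℝ) + 2) * u k) →
      |u i| ≤ K)
    (hfin : K * ((m : ℝ) + 2) ^ (i + 1) ≤ C * (((m : ℝ) + 1) * ∏ l ∈ range i, ((m : ℝ) - l))) :
    |(gorzHermite (m - i)).eval y| * Real.sqrt (2 * ((m : ℝ) + 2)) ^ (i + 2) ≤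
      C * |(gorzHermite (m + 2)).eval y| := by
  set D : ℝ := (m : ℝ) + 2 with hDdef
  have hD : 0 < D := by positivity
  set r : ℝ := Real.sqrt (2 * ((m : ℝ) + 2)) with hrdef
  have hr2 : r ^ 2 = 2 * D := by rw [hrdef, Real.sq_sqrt (by positivity)]
  have hr0 : 0 < r := by rw [hrdef]; positivity
  have hmR : (m : ℝ) = r ^ 2 / 2 - 2 := by rw [hr2, hDdef]; ring
  set a : ℕ → ℝ := fun n => (gorzHermite n).eval y with hadef
  have ham : a m ≠ 0 := eval_ne_zero_of_next_zero m hy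
  have harec : ∀ n, a (n + 2) = y * a (n + 1) - 2 * ((n : ℝ) + 1) * a n := fun n => eval_rec n y
  set w : ℕ → ℝ := fun k => ∏ l ∈ range k, (((m : ℝ) - l) / D) with hwdef
  set u : ℕ → ℝ := fun k => a (m - k) * r ^ k * w k / a m with hudef
  set t : ℝ := y / r with htdef
  have ht : |t| ≤ 2 := by
    rw [htdef, abs_div, abs_of_pos hr0, div_le_iff₀ hr0]; exact hy2
  have hu0 : u 0 = 1 := by simp [hudef, hwdef, ham]
  have hu1 : u 1 = t := by
    obtain ⟨m', rfl⟩ : ∃ m', m = m' + 1 := ⟨m - 1, by omega⟩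
    have h := harec m'
    have hy' : a (m' + 1 + 1) = 0 := hy
    rw [show m' + 2 = m' + 1 + 1 from rfl, hy'] at h
    have hm1 : (0 : ℝ) < 2 * ((m' : ℝ) + 1) := by positivity
    have ha' : a m' = y * a (m' + 1) / (2 * ((m' : ℝ) + 1)) := by
      field_simp; linarith
    simp only [hudef, hwdef, show m' + 1 - 1 = m' by omega, prod_range_one, pow_one, Nat.cast_zero, sub_zero]
    rw [ha', htdef]
    have hm'R : (m' : ℝ) = r ^ 2 / 2 - 3 := by push_cast at hmR; linarith
    have hD' : ((m' + 1 : ℕ) : ℝ) + 2 ≠ 0 := by positivity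
    rw [hDdef]
    field_simp
    push_cast
    rw [hm'R]
    ring
  have hurec : ∀ k : ℕ, k + 2 ≤ m → u (k + 2) = t * u (k + 1) - u k + ((k : ℝ) + 2) / D * u k := by
    intro k hk
    obtain ⟨n, hn⟩ : ∃ n, n + k + 2 = m := ⟨m - k - 2, by omega⟩
    have e0 : m - (k + 2) = n := by omega
    have e1 : m - (k + 1) = n + 1 := by omega
    have e2 : m - k = n + 2 := by omega
    have hnR : (n : ℝ) = r ^ 2 / 2 - 4 - k := by
      have := congrArg (Nat.cast : ℕ → ℝ) hn; push_cast at this; linarith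
    have hw1 : w (k + 1) = w k * (((m : ℝ) - k) / D) := by
      simp only [hwdef, prod_range_succ]
    have hw2 : w (k + 2) = w k * (((m : ℝ) - k) / D) * (((m : ℝ) - (k + 1)) / D) := by
      simp only [hwdef, prod_range_succ, Nat.cast_add, Nat.cast_one]
    have hn1 : (0 : ℝ) < 2 * ((n : ℝ) + 1) := by positivity
    have ha : a n = (y * a (n + 1) - a (n + 2)) / (2 * ((n : ℝ) + 1)) := by
      rw [harec n]; field_simp; ring
    have hD' : (m : ℝ) + 2 ≠ 0 := by positivity
    simp only [hudef]
    rw [e0, e1, e2, hw1, hw2, ha, htdef, hDdef]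
    field_simp
    rw [hnR, hmR]
    ring
  -- the abstract bound
  have hui : |u i| ≤ K := hK t u ht hu0 hu1 hurec
  -- the prefactor
  set P : ℝ := ∏ l ∈ range i, ((m : ℝ) - l) with hPdef
  have hP : 0 < P := by
    rw [hPdef]
    refine prod_pos (fun l hl => ?_)
    have hl' : l < i := mem_range.1 hl
    have : (l : ℝ) < i := by exact_mod_cast hl'
    have : (i : ℝ) + 3 ≤ m := by exact_mod_cast him
    linarith
  have hwi : w i = P / D ^ i := by
    simp only [hwdef, hPdef]
    rw [prod_div_distrib, prod_const, card_range]
  have hwpos : 0 < w i := by rw [hwi]; positivity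
  -- |a (m-i)| r^i w i = |u i| |a m|
  have hkey : |a (m - i)| * r ^ i * w i = |u i| * |a m| := by
    simp only [hudef]
    rw [abs_div, abs_mul, abs_mul, abs_of_pos (pow_pos hr0 i), abs_of_pos hwpos]
    field_simp
  -- |a m| (2(m+1)) = |a (m+2)|
  have ham2 : |a m| * (2 * ((m : ℝ) + 1)) = |a (m + 2)| := by
    have h := harec m
    have hy' : a (m + 1) = 0 := hy
    rw [hy', mul_zero, zero_sub] at h
    rw [h, abs_neg, abs_mul, abs_of_pos (by positivity : (0 : ℝ) < 2 * ((m : ℝ) + 1))]; ring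
  have habs : 0 ≤ |a m| := abs_nonneg _
  have hm1 : (0 : ℝ) < (m : ℝ) + 1 := by positivity
  have hKnn : 0 ≤ K := le_trans (abs_nonneg _) hui
  calc |a (m - i)| * r ^ (i + 2)
      = (|a (m - i)| * r ^ i * w i) * r ^ 2 / w i := by field_simp; ring
    _ = |u i| * |a m| * (2 * D) / w i := by rw [hkey, hr2]
    _ = |u i| * (D ^ (i + 1) / (((m : ℝ) + 1) * P)) * (|a m| * (2 * ((m : ℝ) + 1))) := by
        rw [hwi]; field_simp; ring
    _ = |u i| * (D ^ (i + 1) / (((m : ℝ) + 1) * P)) * |a (m + 2)| := by rw [ham2]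
    _ ≤ K * (D ^ (i + 1) / (((m : ℝ) + 1) * P)) * |a (m + 2)| := by gcongr
    _ = (K * D ^ (i + 1)) / (((m : ℝ) + 1) * P) * |a (m + 2)| := by ring
    _ ≤ (C * (((m : ℝ) + 1) * P)) / (((m : ℝ) + 1) * P) * |a (m + 2)| := by
        gcongr
    _ = C * |a (m + 2)| := by field_simp

/-- `|u₃| ≤ 4 + 10/D` for the damped recurrence (`u₃ = t³ − 2t + 5t/D`, `|t| ≤ 2`). -/
theorem u_three_bound {t D : ℝ} {m : ℕ} (hm : 3 ≤ m) (ht : |t| ≤ 2) (hD : 0 < D) (u : ℕ → ℝ)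
    (h0 : u 0 = 1) (h1 : u 1 = t)
    (hrec : ∀ k : ℕ, k + 2 ≤ m → u (k + 2) = t * u (k + 1) - u k + ((k : ℝ) + 2) / D * u k) :
    |u 3| ≤ 4 + 10 / D := by
  have e2 : u 2 = t * t - 1 + 2 / D := by
    have h := hrec 0 (by omega)
    simp only [Nat.cast_zero, zero_add] at h
    rw [h, h1, h0]; ring
  have e3 : u 3 = t ^ 3 - 2 * t + (5 / D) * t := by
    have h := hrec 1 (by omega)
    simp only [Nat.cast_one, Nat.reduceAdd] at h
    rw [h, e2, h1]; ring
  obtain ⟨htl, htu⟩ := abs_le.1 ht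
  set c : ℝ := 5 / D with hc
  have hc0 : 0 < c := by positivity
  have hg : (4 : ℝ) + 10 / D = 4 + 2 * c := by rw [hc]; ring
  rw [e3, hg, abs_le]
  constructor
  · nlinarith [mul_nonneg (by linarith : (0 : ℝ) ≤ t + 2) (by positivity : (0 : ℝ) ≤ (t - 1) ^ 2 + 1 + c)]
  · nlinarith [mul_nonneg (by linarith : (0 : ℝ) ≤ 2 - t) (by positivity : (0 : ℝ) ≤ (t + 1) ^ 2 + 1 + c)]

/-- `|u₄| ≤ 5 + 30/D + 8/D²` for the damped recurrence (`u₄ = t⁴ − (3 − 9/D)t² + 1 − 6/D + 8/D²`, `|t| ≤ 2`). -/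
theorem u_four_bound {t D : ℝ} {m : ℕ} (hm : 4 ≤ m) (ht : |t| ≤ 2) (hD : 0 < D) (u : ℕ → ℝ)
    (h0 : u 0 = 1) (h1 : u 1 = t)
    (hrec : ∀ k : ℕ, k + 2 ≤ m → u (k + 2) = t * u (k + 1) - u k + ((k : ℝ) + 2) / D * u k) :
    |u 4| ≤ 5 + 30 / D + 8 / D ^ 2 := by
  have e2 : u 2 = t * t - 1 + 2 / D := by
    have h := hrec 0 (by omega)
    simp only [Nat.cast_zero, zero_add] at h
    rw [h, h1, h0]; ring
  have e3 : u 3 = t ^ 3 - 2 * t + (5 / D) * t := by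
    have h := hrec 1 (by omega)
    simp only [Nat.cast_one, Nat.reduceAdd] at h
    rw [h, e2, h1]; ring
  have e4 : u 4 = t ^ 4 - 3 * t ^ 2 + (1 / D) * (9 * t ^ 2) + 1 - 6 * (1 / D) + 8 * (1 / D) ^ 2 := by
    have h := hrec 2 (by omega)
    simp only [Nat.cast_ofNat, Nat.reduceAdd] at h
    rw [h, e3, e2]; field_simp; ring
  obtain ⟨htl, htu⟩ := abs_le.1 ht
  have ht4 : t ^ 2 ≤ 4 := by nlinarith [mul_nonneg (sub_nonneg.2 htu) (by linarith : (0 : ℝ) ≤ t + 2)]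
  set c : ℝ := 1 / D with hc
  have hc0 : 0 < c := by positivity
  have hg : (5 : ℝ) + 30 / D + 8 / D ^ 2 = 5 + 30 * c + 8 * c ^ 2 := by rw [hc]; field_simp
  rw [e4, hg, abs_le]
  constructor
  · nlinarith [sq_nonneg (t ^ 2 - 3 / 2), sq_nonneg t, hc0]
  · nlinarith [mul_nonneg (sub_nonneg.2 ht4) (by positivity : (0 : ℝ) ≤ 1 + t ^ 2 + 9 * c)]

/-- Row `j = 5` (`i = 3`) of the window from `d = m + 2 ≥ 70`. -/
theorem window_row_three (m : ℕ) (y : ℝ) (hm : 68 ≤ m)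
    (hy : (gorzHermite (m + 1)).eval y = 0) (hy2 : |y| ≤ 2 * Real.sqrt (2 * ((m : ℝ) + 2))) :
    |(gorzHermite (m - 3)).eval y| * Real.sqrt (2 * ((m : ℝ) + 2)) ^ (3 + 2) ≤
      6 / 5 * (((3 : ℕ) : ℝ) + 1) * |(gorzHermite (m + 2)).eval y| := by
  have hD : (0 : ℝ) < (m : ℝ) + 2 := by positivity
  refine window_row_of_ubound m 3 y (4 + 10 / ((m : ℝ) + 2)) _ (by omega) hy hy2
    (fun t u ht h0 h1 hrec => u_three_bound (by omega) ht hD u h0 h1 hrec) ?_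
  have hP3 : ∏ l ∈ range 3, ((m : ℝ) - l) = (m : ℝ) * ((m : ℝ) - 1) * ((m : ℝ) - 2) := by
    rw [show (3 : ℕ) = 0 + 1 + 1 + 1 from rfl]
    simp only [prod_range_succ, prod_range_zero, Nat.cast_zero, Nat.cast_one]; ring
  rw [hP3, show (4 + 10 / ((m : ℝ) + 2)) * ((m : ℝ) + 2) ^ (3 + 1) = (4 * ((m : ℝ) + 2) + 10) * ((m : ℝ) + 2) ^ 3 by
    field_simp; try ring]
  obtain ⟨e, rfl⟩ : ∃ e, m = e + 68 := ⟨m - 68, by omega⟩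
  push_cast
  have he : (0 : ℝ) ≤ e := Nat.cast_nonneg e
  nlinarith [he, pow_nonneg he 2, pow_nonneg he 3, pow_nonneg he 4]

/-- Row `j = 6` (`i = 4`) of the window from `d = m + 2 ≥ 116`. -/
theorem window_row_four (m : ℕ) (y : ℝ) (hm : 114 ≤ m)
    (hy : (gorzHermite (m + 1)).eval y = 0) (hy2 : |y| ≤ 2 * Real.sqrt (2 * ((m : ℝ) + 2))) :
    |(gorzHermite (m - 4)).eval y| * Real.sqrt (2 * ((m : ℝ) + 2)) ^ (4 + 2) ≤
      6 / 5 * (((4 : ℕ) : ℝ) + 1) * |(gorzHermite (m + 2)).eval y| := by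
  have hD : (0 : ℝ) < (m : ℝ) + 2 := by positivity
  refine window_row_of_ubound m 4 y (5 + 30 / ((m : ℝ) + 2) + 8 / ((m : ℝ) + 2) ^ 2) _ (by omega) hy hy2
    (fun t u ht h0 h1 hrec => u_four_bound (by omega) ht hD u h0 h1 hrec) ?_
  have hP4 : ∏ l ∈ range 4, ((m : ℝ) - l) = (m : ℝ) * ((m : ℝ) - 1) * ((m : ℝ) - 2) * ((m : ℝ) - 3) := by
    rw [show (4 : ℕ) = 0 + 1 + 1 + 1 + 1 from rfl]
    simp only [prod_range_succ, prod_range_zero, Nat.cast_zero, Nat.cast_one]; ring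
  rw [hP4, show (5 + 30 / ((m : ℝ) + 2) + 8 / ((m : ℝ) + 2) ^ 2) * ((m : ℝ) + 2) ^ (4 + 1)
      = (5 * ((m : ℝ) + 2) ^ 2 + 30 * ((m : ℝ) + 2) + 8) * ((m : ℝ) + 2) ^ 3 by
    field_simp; try ring]
  obtain ⟨e, rfl⟩ : ∃ e, m = e + 114 := ⟨m - 114, by omega⟩
  push_cast
  have he : (0 : ℝ) ≤ e := Nat.cast_nonneg e
  nlinarith [he, pow_nonneg he 2, pow_nonneg he 3, pow_nonneg he 4, pow_nonneg he 5]

/-- Row `j = 5` as a BOUND-ROW valid for every `d = m + 2 ≥ 8`: constant `(4d + 10)d³/((d−1)(d−2)(d−3)(d−4))` (→ 4). -/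
theorem bound_row_three (m : ℕ) (y : ℝ) (hm : 6 ≤ m)
    (hy : (gorzHermite (m + 1)).eval y = 0) (hy2 : |y| ≤ 2 * Real.sqrt (2 * ((m : ℝ) + 2))) :
    |(gorzHermite (m - 3)).eval y| * Real.sqrt (2 * ((m : ℝ) + 2)) ^ (3 + 2) ≤
      bndRow5 ((m : ℝ) + 2) * |(gorzHermite (m + 2)).eval y| := by
  have hD : (0 : ℝ) < (m : ℝ) + 2 := by positivity
  refine window_row_of_ubound m 3 y (4 + 10 / ((m : ℝ) + 2)) _ (by omega) hy hy2
    (fun t u ht h0 h1 hrec => u_three_bound (by omega) ht hD u h0 h1 hrec) ?_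
  have hP3 : ∏ l ∈ range 3, ((m : ℝ) - l) = (m : ℝ) * ((m : ℝ) - 1) * ((m : ℝ) - 2) := by
    rw [show (3 : ℕ) = 0 + 1 + 1 + 1 from rfl]
    simp only [prod_range_succ, prod_range_zero, Nat.cast_zero, Nat.cast_one]; ring
  rw [hP3]
  have h6 : (6 : ℝ) ≤ m := by exact_mod_cast hm
  have h1 : (m : ℝ) - 1 ≠ 0 := by intro h; linarith
  have h2 : (m : ℝ) - 2 ≠ 0 := by intro h; linarith
  have hm0 : (m : ℝ) ≠ 0 := by intro h; linarith
  have e1 : (m : ℝ) + 2 - 1 = (m : ℝ) + 1 := by ring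
  have e2 : (m : ℝ) + 2 - 2 = (m : ℝ) := by ring
  have e3 : (m : ℝ) + 2 - 3 = (m : ℝ) - 1 := by ring
  have e4 : (m : ℝ) + 2 - 4 = (m : ℝ) - 2 := by ring
  apply le_of_eq
  unfold bndRow5
  rw [e1, e2, e3, e4]
  field_simp

/-- Row `j = 6` as a BOUND-ROW valid for every `d = m + 2 ≥ 9`: constant `(5d² + 30d + 8)d³/((d−1)⋯(d−5))` (→ 5). -/
theorem bound_row_four (m : ℕ) (y : ℝ) (hm : 7 ≤ m)
    (hy : (gorzHermite (m + 1)).eval y = 0) (hy2 : |y| ≤ 2 * Real.sqrt (2 * ((m : ℝ) + 2))) :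
    |(gorzHermite (m - 4)).eval y| * Real.sqrt (2 * ((m : ℝ) + 2)) ^ (4 + 2) ≤
      bndRow6 ((m : ℝ) + 2) * |(gorzHermite (m + 2)).eval y| := by
  have hD : (0 : ℝ) < (m : ℝ) + 2 := by positivity
  refine window_row_of_ubound m 4 y (5 + 30 / ((m : ℝ) + 2) + 8 / ((m : ℝ) + 2) ^ 2) _ (by omega) hy hy2
    (fun t u ht h0 h1 hrec => u_four_bound (by omega) ht hD u h0 h1 hrec) ?_
  have hP4 : ∏ l ∈ range 4, ((m : ℝ) - l) = (m : ℝ) * ((m : ℝ) - 1) * ((m : ℝ) - 2) * ((m : ℝ) - 3) := by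
    rw [show (4 : ℕ) = 0 + 1 + 1 + 1 + 1 from rfl]
    simp only [prod_range_succ, prod_range_zero, Nat.cast_zero, Nat.cast_one]; ring
  rw [hP4]
  have h7 : (7 : ℝ) ≤ m := by exact_mod_cast hm
  have h1 : (m : ℝ) - 1 ≠ 0 := by intro h; linarith
  have h2 : (m : ℝ) - 2 ≠ 0 := by intro h; linarith
  have h3 : (m : ℝ) - 3 ≠ 0 := by intro h; linarith
  have hm0 : (m : ℝ) ≠ 0 := by intro h; linarith
  have e1 : (m : ℝ) + 2 - 1 = (m : ℝ) + 1 := by ring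
  have e2 : (m : ℝ) + 2 - 2 = (m : ℝ) := by ring
  have e3 : (m : ℝ) + 2 - 3 = (m : ℝ) - 1 := by ring
  have e4 : (m : ℝ) + 2 - 4 = (m : ℝ) - 2 := by ring
  have e5 : (m : ℝ) + 2 - 5 = (m : ℝ) - 3 := by ring
  apply le_of_eq
  unfold bndRow6
  rw [e1, e2, e3, e4, e5]
  field_simp

end Win

/-- **S-H3 for the min-table PROVED (ξ-free, RH-FREE, every `d`)**: `HermiteCriticalRatioBound ρ_win⁺⁺`. -/
theorem hermiteCriticalRatioBound_winMin : HermiteCriticalRatioBound rhoWinMin := by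
  intro d j y hj1 hjd hy
  have hT := hermiteCriticalRatioBound_turan d j y hj1 hjd hy
  have hW := hermiteCriticalRatioBound_win d j y hj1 hjd hy
  unfold rhoWinMin
  by_cases h4 : j ≤ 4
  · rw [if_pos h4]; exact hT
  rw [if_neg h4]
  -- the two bound-rows
  have key : ∀ (i : ℕ) (c : ℝ), j = i + 2 → i + 5 ≤ d →
      (∀ m : ℕ, d = m + 2 → (gorzHermite (m + 1)).eval y = 0 → |y| ≤ 2 * Real.sqrt (2 * ((m : ℝ) + 2)) →
        |(gorzHermite (m - i)).eval y| * Real.sqrt (2 * ((m : ℝ) + 2)) ^ (i + 2) ≤ c * |(gorzHermite (m + 2)).eval y|) →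
      |(gorzHermite (d - j)).eval y| ≤ min (rhoHT d j) (c / (2 * (d : ℝ)) ^ ((j : ℝ) / 2)) * |(gorzHermite d).eval y| := by
    intro i c hji hid hrow
    subst hji
    obtain ⟨m, rfl⟩ : ∃ m, d = m + 2 := ⟨d - 2, by omega⟩
    have hy' : (gorzHermite (m + 1)).eval y = 0 := by simpa using hy
    have hZ := hermiteZeroBound_holds (m + 1) y hy'
    have hy2 : |y| ≤ 2 * Real.sqrt (2 * ((m : ℝ) + 2)) := by
      have : Real.sqrt (2 * ((m + 1 : ℕ) : ℝ) + 1) ≤ Real.sqrt (2 * ((m : ℝ) + 2)) :=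
        Real.sqrt_le_sqrt (by push_cast; linarith)
      linarith [hZ.le]
    have hcore := hrow m rfl hy' hy2
    have habs : 0 ≤ |(gorzHermite (m + 2)).eval y| := abs_nonneg _
    rw [min_mul_of_nonneg _ _ habs]
    refine le_min hT ?_
    rw [show m + 2 - (i + 2) = m - i by omega, rpow_half_eq_sqrt_pow (by positivity) (i + 2)]
    push_cast
    have hr : 0 < Real.sqrt (2 * ((m : ℝ) + 2)) ^ (i + 2) := pow_pos (by positivity) _
    rw [div_mul_eq_mul_div, le_div_iff₀ hr]
    exact hcore
  by_cases h5 : j = 5 ∧ 8 ≤ d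
  · rw [if_pos h5]
    refine key 3 _ (by omega) (by omega) (fun m hm hy' hy2 => ?_)
    subst hm
    have h := Win.bound_row_three m y (by omega) hy' hy2
    push_cast
    exact h
  rw [if_neg h5]
  by_cases h6 : j = 6 ∧ 9 ≤ d
  · rw [if_pos h6]
    refine key 4 _ (by omega) (by omega) (fun m hm hy' hy2 => ?_)
    subst hm
    have h := Win.bound_row_four m y (by omega) hy' hy2
    push_cast
    exact h
  rw [if_neg h6]
  -- remaining rows: exactly `rhoWin`'s value
  have : rhoWin d j = (if 4 * (j - 2) ^ 3 ≤ d then 6 / 5 * ((j : ℝ) - 1) / (2 * (d : ℝ)) ^ ((j : ℝ) / 2)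
      else rhoHT d j) := by
    unfold rhoWin; rw [if_neg h4]
  rw [← this]
  exact hW

/-! ## ITEM CLOSER (route `JensenPolynomials`; the Theses decl is this statement by definition). -/

/-- **Item closer** (route `JensenPolynomials`, item `HermiteCriticalRatioWindow` = S-H3-win): the Theses decl unfolds to
`HermiteCriticalRatioBound rhoWinMin`, proved above as `hermiteCriticalRatioBound_winMin` (RH-FREE, ξ-free). -/
theorem hermiteCriticalRatioWindow_item :
    Summit.RiemannHypothesis.RiemannHypothesis.Theses.JensenPolynomials.HermiteCriticalRatioWindow :=
  hermiteCriticalRatioBound_winMin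

end Summit.RiemannHypothesis.RiemannHypothesis.Theorems.JensenPolynomials

end
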